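import Mathlib
import HarnessLib
import Summits.HubbardSuperconductivity.HubbardSuperconductivity.Theorems.KLProgrammeKLRegimeFlowReadScaleZeroSecondOrderKernel
import Summits.HubbardSuperconductivity.HubbardSuperconductivity.Theorems.KLProgrammeKLRegimeEngineFrameShiftResponseDoorCT
import Literature.MathematicalPhysics.QuantumLattice.HubbardGridCounterQuadratic
import Literature.MathematicalPhysics.QuantumLattice.HubbardInteractionMoments
import Literature.Probability.LatticeModels.TorusFourierWeightedConvolution
import Summits.HubbardSuperconductivity.HubbardSuperconductivity.Theorems.KLProgrammeKLRegimeSplitFieldStrengthSectorStatic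

/-!
# Route `KLProgramme`, crux K3 — gen-8 ENGINE-FLOW child (stmt-HubbardSuperconductivity-20437 `KLRegimeEngineV17F2`), stub (C) at `n = 0`,
# located item #22a «(C)-SCALE0-PT2», step (π2a): THE HARTREE CHAIN'S MOMENTUM SYMBOL — the grid image of a covariance-weighted quadratic
# `Σ_{p,q,σ} (S_NᵀC_ΨS_N)((q,σ)⁺,(p,σ)⁻)·ψ⁺_{pσ}ψ⁻_{qσ}` has self-energy `(N²/(β³L²))·Ψ(K,σ)` — the covariance's OWN symbol, an `e(k⃗)`-function

Seat hubbard-kl-k3c5-p1 (g13; owner of #22a).  By `kernel_two_scaleZero_effAction_offDiag` (π1b, `…FlowReadScaleZeroSecondOrderKernel`) the off-diagonal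
two-leg kernel of the scale-`0` grid output `W₀` is SUNSET + HARTREE CHAIN + `R₃`, the chain being the quadratic grid element
`W_chain = Σ_{p,q,σ} (Uε)²t₀²·A((q,σ)⁺,(p,σ)⁻)·ψ⁺_{pσ}ψ⁻_{qσ}` with `A = contr (S_{4M}ᵀC⁰_{>e₀}S_{4M}) = −(S_{4M}ᵀC⁰_{>e₀}S_{4M})` (antisymmetry).  The receiving MIXED door
(k3c3-p1, p608958) takes `W_b := W_chain` through the on-curve jets of its interpolated symbol `loc(map S W_chain)`; this file computes that symbol
EXACTLY: under the grid substitution the chain becomes the momentum-DIAGONAL quadratic with symbol `∝ Ψ⁰(K)` (`uvSymbolCT`), i.e. a function of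
`(ω, e(k⃗))` only — hence θ-CONSTANT on the free Fermi curve up to `I_L`-aliasing (the alias step is π2c).

* §1 `sum_conj_vertexPlaneWave_zero_mul_one_grid` / `…one_mul_zero_grid` — plane-wave orthogonality on the `N`-point space–time grid (`2M ≤ N`):
  `Σ_{(j,x⃗)} conj(e^{−ik·p}) conj(e^{+ik′·p}) = N L²·[k = k′]` (p3's time orthogonality `sum_conj_vertexPlaneWave_zero_mul_one_gridTime` + characters);
* §1 `selfEnergy_map_gridSub_gen_mul_gen` — `Σ[map S_N (ψ⁺_{pσ′}ψ⁻_{qσ′})](K,σ) = [σ′ = σ]·βL²·(βL²)⁻²·conj(e^{−iK·p})conj(e^{+iK·q})`;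
* §1 **`selfEnergy_map_gridSub_pullbackQuadratic`** — for ANY normal momentum covariance `C_Ψ = normalCovariance Ψ`, `2M ≤ N`, `β ≠ 0`:
  `Σ[map S_N (Σ_{p,q,σ′} (S_NᵀC_ΨS_N)((q,σ′)⁺,(p,σ′)⁻)·ψ⁺_{pσ′}ψ⁻_{qσ′})](K,σ) = (N²/(β³L²))·Ψ(K,σ)`.

Pure algebra; no definitions; nothing about sizes; nothing asserts any stub of 20437, K3 or superconductivity.
References: BGM 2006 §2.1 (2.3)–(2.5) [cite: BenfattoGiulianiMastropietro2006]; Salmhofer 1999 §4.2.4 (4.59) [cite: Salmhofer1999].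
-/

noncomputable section

namespace Summit.HubbardSuperconductivity.HubbardSuperconductivity.Theorems.KLRegimeSplit

set_option linter.dupNamespace false -- summit = problem name (single-conjunct summit), D-0017

open Literature.MathematicalPhysics.QuantumLattice Literature.Probability.LatticeModels GrassmannAlgebra Finset Matrix
open Summit.HubbardSuperconductivity.HubbardSuperconductivity.Theorems.EngineV8
open Summit.HubbardSuperconductivity.HubbardSuperconductivity.Theorems.TwoLegFourier (selfEnergy_finset_sum)
open scoped ComplexConjugate

section Generic

variable {L M N : ℕ} [NeZero L]

/-- **Plane-wave orthogonality on the space–time grid, `(+,−)` order**: for `2M ≤ N`, `β ≠ 0`,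
`Σ_{(j,x⃗)} conj(e^{-ik·(x⃗,τ_j)}) conj(e^{+ik'·(x⃗,τ_j)}) = N L²·[k = k']`. -/
theorem sum_conj_vertexPlaneWave_zero_mul_one_grid {β : ℝ} (hβ : β ≠ 0) (hN : 2 * M ≤ N) (k k' : FreqMomentum L M) :
    ∑ p : GridPoint L N, conj (vertexPlaneWave L M β 0 k p.2 (gridTime β N p.1)) * conj (vertexPlaneWave L M β 1 k' p.2 (gridTime β N p.1)) =
      if k = k' then ((N : ℂ) * (L : ℂ) ^ 2) else 0 := by
  rw [Fintype.sum_prod_type, Finset.sum_comm]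
  simp_rw [sum_conj_vertexPlaneWave_zero_mul_one_gridTime hβ hN]
  rw [← Finset.mul_sum]
  simp_rw [torusChar_mul_conj_torusChar]
  rw [sum_torusChar_right]
  by_cases h : k = k'
  · subst h; simp
  · rw [if_neg h]
    by_cases h1 : k.1 = k'.1
    · have h2 : k.2 - k'.2 ≠ 0 := fun h' => h (Prod.ext h1 (sub_eq_zero.1 h'))
      rw [if_pos h1, if_neg h2, mul_zero]
    · rw [if_neg h1, zero_mul]

/-- The same in the `(−,+)` order: `Σ_{(j,x⃗)} conj(e^{+ik'·p}) conj(e^{-ik·p}) = N L²·[k = k']`. -/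
theorem sum_conj_vertexPlaneWave_one_mul_zero_grid {β : ℝ} (hβ : β ≠ 0) (hN : 2 * M ≤ N) (k k' : FreqMomentum L M) :
    ∑ p : GridPoint L N, conj (vertexPlaneWave L M β 1 k' p.2 (gridTime β N p.1)) * conj (vertexPlaneWave L M β 0 k p.2 (gridTime β N p.1)) =
      if k = k' then ((N : ℂ) * (L : ℂ) ^ 2) else 0 := by
  simp_rw [mul_comm (conj (vertexPlaneWave L M β 1 _ _ _))]
  exact sum_conj_vertexPlaneWave_zero_mul_one_grid hβ hN k k'

/-- **The self-energy of the grid image of a `ψ⁺ψ⁻` grid monomial**: `Σ[map S (ψ⁺_{pσ'}ψ⁻_{qσ'})](K,σ) = [σ' = σ]·βL²·(βL²)⁻²·conj(e^{-iK·p})·conj(e^{iK·q})`. -/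
theorem selfEnergy_map_gridSub_gen_mul_gen (β : ℝ) (p q : GridPoint L N) (σ σ' : Fin 2) (K : FreqMomentum L M) :
    selfEnergy L M β (ExteriorAlgebra.map (Matrix.toLin' (hubbardGridSub L M β N))
        (gen ℂ (((p, σ'), 0) : GridLeg (GridPoint L N)) * gen ℂ (((q, σ'), 1) : GridLeg (GridPoint L N)))) K σ =
      if σ' = σ then ((β * (L : ℝ) ^ 2 : ℝ) : ℂ) *
        ((((1 / (β * (L : ℝ) ^ 2) : ℝ) : ℂ) * conj (vertexPlaneWave L M β 0 K p.2 (gridTime β N p.1))) *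
          (((1 / (β * (L : ℝ) ^ 2) : ℝ) : ℂ) * conj (vertexPlaneWave L M β 1 K q.2 (gridTime β N q.1)))) else 0 := by
  rw [map_mul, hubbardGridSub, map_gridSub_gen, map_gridSub_gen, positionField_mul_positionField, selfEnergy_eq_const_mul_kernel,
    kernel_sum]
  simp_rw [kernel_sum, kernel_smul, kernel_two_gen_mul_gen]
  simp only [Matrix.cons_val_zero, Matrix.cons_val_one, Prod.mk.injEq, and_true, one_ne_zero, and_false, if_false,
    zero_ne_one, mul_zero, sub_zero]
  by_cases hσ : σ' = σ
  · subst hσ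
    simp only [and_true, if_true]
    -- collapse `k = K`, `k' = K`
    have hcol : ∀ (k k' : FreqMomentum L M),
        (((1 / (β * (L : ℝ) ^ 2) : ℝ) : ℂ) * conj (vertexPlaneWave L M β 0 k p.2 (gridTime β N p.1)) *
          (((1 / (β * (L : ℝ) ^ 2) : ℝ) : ℂ) * conj (vertexPlaneWave L M β 1 k' q.2 (gridTime β N q.1)))) *
          ((2 : ℂ)⁻¹ * ((if K = k then 1 else 0) * (if K = k' then 1 else 0))) =
        (if K = k then (1 : ℂ) else 0) * ((if K = k' then (1 : ℂ) else 0) *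
          ((2 : ℂ)⁻¹ * ((((1 / (β * (L : ℝ) ^ 2) : ℝ) : ℂ) * conj (vertexPlaneWave L M β 0 K p.2 (gridTime β N p.1))) *
            (((1 / (β * (L : ℝ) ^ 2) : ℝ) : ℂ) * conj (vertexPlaneWave L M β 1 K q.2 (gridTime β N q.1)))))) := by
      intro k k'
      by_cases h1 : K = k
      · by_cases h2 : K = k'
        · subst h1; subst h2; simp only [if_true]; ring
        · simp only [h2, if_false, mul_zero, zero_mul]
      · simp only [h1, if_false, mul_zero, zero_mul]
    simp_rw [hcol, ← Finset.mul_sum, ← Finset.sum_mul, Finset.sum_ite_eq, Finset.mem_univ, if_true]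
    push_cast [Nat.factorial]
    ring
  · rw [if_neg hσ]
    have hσ' : ¬σ = σ' := fun h => hσ h.symm
    simp only [hσ', and_false, if_false, mul_zero, Finset.sum_const_zero]

/-- **THE GRID IMAGE OF A COVARIANCE-WEIGHTED QUADRATIC HAS THE COVARIANCE'S OWN SYMBOL** (`2M ≤ N`, `β ≠ 0`): for a normal momentum
covariance `C_Ψ` and the grid quadratic `Q := Σ_{p,q,σ'} (S_NᵀC_ΨS_N)((q,σ'),+;(p,σ'),−)·ψ⁺_{pσ'}ψ⁻_{qσ'}` (coefficient = the pulled-back `(+,−)` ENTRY from `q` to `p`),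
`Σ[map S_N Q](K,σ) = (N²/(β³L²))·Ψ(K,σ)` — plane-wave orthogonality twice. -/
theorem selfEnergy_map_gridSub_pullbackQuadratic {β : ℝ} (hβ : β ≠ 0) (hN : 2 * M ≤ N) (Ψ : FreqMomentum L M × Fin 2 → ℂ)
    (K : FreqMomentum L M) (σ : Fin 2) :
    selfEnergy L M β (ExteriorAlgebra.map (Matrix.toLin' (hubbardGridSub L M β N))
        (∑ p : GridPoint L N, ∑ q : GridPoint L N, ∑ σ' : Fin 2,
          ((hubbardGridSub L M β N).transpose * normalCovariance L M Ψ * hubbardGridSub L M β N)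
              (((q, σ'), 0) : GridLeg (GridPoint L N)) ((p, σ'), 1) •
            (gen ℂ (((p, σ'), 0) : GridLeg (GridPoint L N)) * gen ℂ (((q, σ'), 1) : GridLeg (GridPoint L N))))) K σ =
      (((N : ℂ) ^ 2 / (β ^ 3 * (L : ℝ) ^ 2 : ℝ)) : ℂ) * Ψ (K, σ) := by
  have hβc : (β : ℂ) ≠ 0 := by exact_mod_cast hβ
  have hLc : (L : ℂ) ≠ 0 := by exact_mod_cast NeZero.ne L
  simp only [map_sum, map_smul, selfEnergy_finset_sum, selfEnergy_smul', selfEnergy_map_gridSub_gen_mul_gen, mul_ite, mul_zero,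
    Finset.sum_ite_eq', Finset.mem_univ, if_true]
  -- expand the pulled-back entry: `Σ_k u conj(e⁺_k(q)) Ψ(k) u conj(e⁻_k(p))`
  have hentry : ∀ p q : GridPoint L N,
      ((hubbardGridSub L M β N).transpose * normalCovariance L M Ψ * hubbardGridSub L M β N)
          (((q, σ), 0) : GridLeg (GridPoint L N)) ((p, σ), 1) =
        ∑ k : FreqMomentum L M, (((1 / (β * (L : ℝ) ^ 2) : ℝ) : ℂ) * conj (vertexPlaneWave L M β 0 k q.2 (gridTime β N q.1))) *
          Ψ (k, σ) * (((1 / (β * (L : ℝ) ^ 2) : ℝ) : ℂ) * conj (vertexPlaneWave L M β 1 k p.2 (gridTime β N p.1))) := by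
    intro p q
    rw [hubbardGridSub, gridSub_pullback_apply]
    refine Finset.sum_congr rfl fun k _ => ?_
    simp only [normalCovariance_apply, Prod.mk.injEq, and_true, and_self, if_true, one_ne_zero, zero_ne_one, if_false,
      mul_ite, mul_zero, ite_mul, zero_mul, Finset.sum_ite_eq, Finset.mem_univ]
  simp_rw [hentry, Finset.sum_mul]
  simp_rw [Finset.sum_comm (s := (Finset.univ : Finset (GridPoint L N))) (t := (Finset.univ : Finset (FreqMomentum L M)))]
  -- per frequency–momentum `k`: factor the `(p, q)` double sum into the two plane-wave orthogonality sums
  have hfac : ∀ k : FreqMomentum L M,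
      ∑ p : GridPoint L N, ∑ q : GridPoint L N,
        (((1 / (β * (L : ℝ) ^ 2) : ℝ) : ℂ) * conj (vertexPlaneWave L M β 0 k q.2 (gridTime β N q.1))) * Ψ (k, σ) *
            (((1 / (β * (L : ℝ) ^ 2) : ℝ) : ℂ) * conj (vertexPlaneWave L M β 1 k p.2 (gridTime β N p.1))) *
          (((β * (L : ℝ) ^ 2 : ℝ) : ℂ) *
            ((((1 / (β * (L : ℝ) ^ 2) : ℝ) : ℂ) * conj (vertexPlaneWave L M β 0 K p.2 (gridTime β N p.1))) *
              (((1 / (β * (L : ℝ) ^ 2) : ℝ) : ℂ) * conj (vertexPlaneWave L M β 1 K q.2 (gridTime β N q.1))))) =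
        ((β * (L : ℝ) ^ 2 : ℝ) : ℂ) * (((1 / (β * (L : ℝ) ^ 2) : ℝ) : ℂ)) ^ 4 * Ψ (k, σ) *
          ((∑ p : GridPoint L N, conj (vertexPlaneWave L M β 1 k p.2 (gridTime β N p.1)) * conj (vertexPlaneWave L M β 0 K p.2 (gridTime β N p.1))) *
           (∑ q : GridPoint L N, conj (vertexPlaneWave L M β 0 k q.2 (gridTime β N q.1)) * conj (vertexPlaneWave L M β 1 K q.2 (gridTime β N q.1)))) := by
    intro k
    rw [Finset.sum_mul_sum, Finset.mul_sum]
    refine Finset.sum_congr rfl fun p _ => ?_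
    rw [Finset.mul_sum]
    refine Finset.sum_congr rfl fun q _ => ?_
    ring
  simp_rw [hfac, sum_conj_vertexPlaneWave_one_mul_zero_grid hβ hN, sum_conj_vertexPlaneWave_zero_mul_one_grid hβ hN]
  simp only [mul_ite, mul_zero, ite_mul, zero_mul, Finset.sum_ite_eq', Finset.mem_univ, if_true]
  push_cast
  field_simp

end Generic

end Summit.HubbardSuperconductivity.HubbardSuperconductivity.Theorems.KLRegimeSplit

end
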